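import Summits.NavierStokesRegularity.NavierStokesRegularity.Theses.PalasekTowerBreakdown
import Summits.NavierStokesRegularity.FluidComputer.PalasekTowerHeredityOrBreakdownAt

/-!
# NavierStokesRegularity — route `PalasekTowerBreakdown`, item `HeredityAtOne`: the first rung minus «no premature
# blow-up» still closes the route; the registered upper stub `AprioriCeilingAt 1` splits, by name

Supports `stmt-NavierStokesRegularity-19249` (`PalasekTowerBreakdown.HeredityAtOne`; it does NOT close it) — the
`k = 1` MIRROR of this seat's `Theorems/PalasekTowerBreakdownHeredityFromTwoOrBreakdown.lean` (p473734, item 19250).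
Cell `ns-blowup`, seat `ns-palasek-19250-p2` (g2); holder of record of 19249: ecbridge-1 (skeleton v3:
`stub_apriori_ceiling_at_one`, `stub_speed_floor_at_one`, `stub_strain_floor_at_one`, `stub_core_floor_at_one`).
LABEL: E–C typing + kernel glue over `FluidComputer/PalasekTowerHeredityOrBreakdown{,Ceiling,At}.lean`. WHAT THIS
IS NOT: not NS — nothing constructed; the item is OPEN and appears only inside equivalences / implications; no stub
is decided.

THE OBSERVATION (k = 1). `AprioriCeilingAt 1` quantifies over every PARTIAL continuation `[0, T'] ⊆ [0, τ₂]` of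
every registered level-1 stage, so a registered design whose flow overshoots `c₂ Y₂` at some `T' < τ₂` and then
loses smoothness before `τ₂` refutes 19249 — yet that design IS Fefferman's (C)
(`Stage.navierStokesBreakdownR3_of_not_livesTo`). By name:

* `palasekTowerBreakdown_heredityAtOne_iff_orBreakdown_and_noPrematureBreakdown` — the item is its weak form
  `HeredityOrBreakdownAt 1` plus `NoPrematureBreakdownAt 1`, and `¬ NoPrematureBreakdownAt 1 → (C)`;
* `palasekTowerBreakdown_breakdownR3_of_base_orBreakdownAt_one_heredityFromTwo` — `closes` with binder 2 WEAKENED;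
* `palasekTowerBreakdown_heredityAtOne_or_breakdownR3_of_orBreakdown`, `…_iff_orBreakdown_of_not_breakdownR3`,
  `…_not_heredityAtOne_dichotomy` — the weak form gives back the item OR (C);
* `palasekTowerBreakdown_stub_apriori_ceiling_at_one_iff : AprioriCeilingAt 1 ↔ NoPrematureBreakdownAt 1 ∧
  WindowCeilingAt 1`; `palasekTowerBreakdown_heredityAtOne_iff_noPrematureBreakdown_windowCeiling_floors3` (item =
  5 conjuncts); `palasekTowerBreakdown_orBreakdownAt_one_iff_windowCeiling_floors3` (weak item = window ceiling +
  the THREE REGISTERED FLOOR STUBS of 19249 verbatim).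

Honest status: lossless for the target; removes one refutation mode and one proof obligation; does NOT make the
window ceiling or the level-2 floors easier (verdict of record stands).

References: S. Palasek, arXiv:2605.13827 §4 [cite: Palasek2026ElementaryModel, §4]; C. L. Fefferman, Clay problem
description, (C) [cite: FeffermanClay2006, (C)]; H. Sohr, *The Navier–Stokes Equations*, Birkhäuser 2001, Ch. V
Thm. 1.5.1 [cite: Sohr2001, Ch. V Thm. 1.5.1].
-/

-- `Summit.<Summit>.<Problem>` is the tree's mandated summit-side namespace (CONVENTIONS §2); for this
-- single-conjunct summit the two coincide, so the duplicate is deliberate.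
set_option linter.dupNamespace false

namespace Summit.NavierStokesRegularity.NavierStokesRegularity.Theorems

open Set MeasureTheory
open scoped ENNReal ContDiff
open Literature.Analysis.FluidPDE
open Summit.NavierStokesRegularity.NavierStokesRegularity.Theses
open Summit.NavierStokesRegularity.FluidComputer.PalasekTowerClayBridge

/-! ## §1 The item, its weak form and the clause -/

/-- **`HeredityAtOne ↔ HeredityOrBreakdownAt 1 ∧ NoPrematureBreakdownAt 1`** — no hypothesis. [folklore] -/
theorem palasekTowerBreakdown_heredityAtOne_iff_orBreakdown_and_noPrematureBreakdown :
    PalasekTowerBreakdown.HeredityAtOne ↔ HeredityOrBreakdownAt 1 ∧ NoPrematureBreakdownAt 1 := by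
  unfold PalasekTowerBreakdown.HeredityAtOne
  rw [heredityAtOne_iff]
  exact heredityAt_iff_orBreakdown_and_noPrematureBreakdown 1

/-- … and the clause is «(C) if false»: `¬ NoPrematureBreakdownAt 1 → NavierStokesBreakdownR3` (a registered
level-1 design whose flow dies inside window 1 IS a Clay breakdown). [cite: FeffermanClay2006, (C)] -/
theorem palasekTowerBreakdown_breakdownR3_of_prematureBreakdown_one (h : ¬ NoPrematureBreakdownAt 1) :
    Summit.NavierStokesRegularity.NavierStokesRegularity.NavierStokesBreakdownR3 :=
  navierStokesBreakdownR3_of_not_noPrematureBreakdownAt h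

/-- **The route's deciding theorem with binder 2 WEAKENED**:
`EpisodeBase → HeredityOrBreakdownAt 1 → HeredityFromTwo → NavierStokesBreakdownR3`. [cite: FeffermanClay2006, (C)] -/
theorem palasekTowerBreakdown_breakdownR3_of_base_orBreakdownAt_one_heredityFromTwo
    (h₁ : PalasekTowerBreakdown.EpisodeBase) (h₂ : HeredityOrBreakdownAt 1)
    (h₃ : PalasekTowerBreakdown.HeredityFromTwo) :
    Summit.NavierStokesRegularity.NavierStokesRegularity.NavierStokesBreakdownR3 := by
  unfold PalasekTowerBreakdown.EpisodeBase at h₁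
  unfold PalasekTowerBreakdown.HeredityFromTwo at h₃
  exact navierStokesBreakdownR3_of_base_orBreakdownAt_one_heredityFrom_two h₁ h₂ h₃

/-! ## §2 The weak form gives back the item — or (C) -/

/-- **`HeredityOrBreakdownAt 1 → HeredityAtOne ∨ NavierStokesBreakdownR3`.** [cite: FeffermanClay2006, (C)] -/
theorem palasekTowerBreakdown_heredityAtOne_or_breakdownR3_of_orBreakdown (h : HeredityOrBreakdownAt 1) :
    PalasekTowerBreakdown.HeredityAtOne ∨
      Summit.NavierStokesRegularity.NavierStokesRegularity.NavierStokesBreakdownR3 := by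
  unfold PalasekTowerBreakdown.HeredityAtOne
  rw [heredityAtOne_iff]
  exact h.heredityAt_or_breakdownR3

/-- In a world without breakdown the first rung and its weak form coincide. [folklore] -/
theorem palasekTowerBreakdown_heredityAtOne_iff_orBreakdown_of_not_breakdownR3
    (hC : ¬ Summit.NavierStokesRegularity.NavierStokesRegularity.NavierStokesBreakdownR3) :
    PalasekTowerBreakdown.HeredityAtOne ↔ HeredityOrBreakdownAt 1 := by
  unfold PalasekTowerBreakdown.HeredityAtOne
  rw [heredityAtOne_iff]
  exact heredityAt_iff_orBreakdown_of_not_breakdownR3 hC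

/-- Any refutation of the first rung either refutes its weak form or proves (C). [folklore] -/
theorem palasekTowerBreakdown_not_heredityAtOne_dichotomy (h : ¬ PalasekTowerBreakdown.HeredityAtOne) :
    ¬ HeredityOrBreakdownAt 1 ∨ Summit.NavierStokesRegularity.NavierStokesRegularity.NavierStokesBreakdownR3 := by
  unfold PalasekTowerBreakdown.HeredityAtOne at h
  rw [heredityAtOne_iff] at h
  exact not_orBreakdown_or_breakdownR3_of_not_heredityAt h

/-! ## §3 The registered stubs of 19249's skeleton v3 under the split -/

/-- **The registered UPPER stub of 19249 splits**: `AprioriCeilingAt 1 ↔ NoPrematureBreakdownAt 1 ∧ WindowCeilingAt 1`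
(`stub_apriori_ceiling_at_one : AprioriCeilingAt 1` of `Cruxes/HeredityAtOne/Lines/birth.lean` v3).
[cite: Sohr2001, Ch. V Thm. 1.5.1] -/
theorem palasekTowerBreakdown_stub_apriori_ceiling_at_one_iff :
    AprioriCeilingAt 1 ↔ NoPrematureBreakdownAt 1 ∧ WindowCeilingAt 1 :=
  aprioriCeilingAt_iff_noPrematureBreakdown_and_windowCeiling le_rfl

/-- **The first rung as FIVE conjuncts matching 19249's skeleton v3**: `HeredityAtOne ↔ NoPrematureBreakdownAt 1 ∧
WindowCeilingAt 1 ∧ SpeedFloorAt 1 ∧ StrainFloorAt 1 ∧ CoreFloorAt 1` — no hypothesis. [folklore] -/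
theorem palasekTowerBreakdown_heredityAtOne_iff_noPrematureBreakdown_windowCeiling_floors3 :
    PalasekTowerBreakdown.HeredityAtOne ↔
      NoPrematureBreakdownAt 1 ∧ WindowCeilingAt 1 ∧ SpeedFloorAt 1 ∧ StrainFloorAt 1 ∧ CoreFloorAt 1 := by
  unfold PalasekTowerBreakdown.HeredityAtOne
  exact heredityAtOne_iff_noPrematureBreakdown_windowCeiling_floors3

/-- **The weak first rung as FOUR conjuncts — 19249's three floor stubs VERBATIM plus the window ceiling**:
`HeredityOrBreakdownAt 1 ↔ WindowCeilingAt 1 ∧ SpeedFloorAt 1 ∧ StrainFloorAt 1 ∧ CoreFloorAt 1`. [folklore] -/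
theorem palasekTowerBreakdown_orBreakdownAt_one_iff_windowCeiling_floors3 :
    HeredityOrBreakdownAt 1 ↔ WindowCeilingAt 1 ∧ SpeedFloorAt 1 ∧ StrainFloorAt 1 ∧ CoreFloorAt 1 :=
  heredityOrBreakdownAt_iff_windowCeiling_floors3 1

/-- **Composition for a re-cut under the weak form** (four by-name hypotheses): window ceiling + 19249's three
registered floor stubs ⇒ `HeredityOrBreakdownAt 1`; with `EpisodeBase` and `HeredityFromTwo` (or its weak form)
this closes the target (`palasekTowerBreakdown_breakdownR3_of_base_orBreakdownAt_one_heredityFromTwo`). [folklore] -/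
theorem palasekTowerBreakdown_orBreakdownAt_one_of_windowCeiling_floors3 (hW : WindowCeilingAt 1)
    (h₁ : SpeedFloorAt 1) (h₂ : StrainFloorAt 1) (h₃ : CoreFloorAt 1) : HeredityOrBreakdownAt 1 :=
  palasekTowerBreakdown_orBreakdownAt_one_iff_windowCeiling_floors3.2 ⟨hW, h₁, h₂, h₃⟩

/-- **The first rung from its five conjuncts** (composition shape). [folklore] -/
theorem palasekTowerBreakdown_heredityAtOne_of_noPrematureBreakdown_windowCeiling_floors3
    (hN : NoPrematureBreakdownAt 1) (hW : WindowCeilingAt 1) (h₁ : SpeedFloorAt 1) (h₂ : StrainFloorAt 1)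
    (h₃ : CoreFloorAt 1) : PalasekTowerBreakdown.HeredityAtOne :=
  palasekTowerBreakdown_heredityAtOne_iff_noPrematureBreakdown_windowCeiling_floors3.2 ⟨hN, hW, h₁, h₂, h₃⟩

/-! ## §4 The base binder in the same key -/

/-- **Every binder of `closes` has its or-breakdown form**: a prepared HOST (registered level-`0` stage) of a
pinned rigid quiet wide design whose flow EITHER does not live to `τ 1` (then the design IS (C)) OR extends to a
registered level-`1` stage (then `EpisodeBase` holds), together with heredity-or-breakdown from level `1`, gives
`NavierStokesBreakdownR3`. (Only the `∃`-form is meaningful at level `0`: the `∀`-over-hosts forms are dead by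
hold-and-release, `Theorems/EpisodeBase/Negative/FirstEpisodeHoldRelease.lean`.) [cite: FeffermanClay2006, (C)] -/
theorem palasekTowerBreakdown_breakdownR3_of_host_orBreakdown_orBreakdownFrom_one
    (h₀ : ∃ S : Schedule TowerRates.wide, S.Pins 8 (6 / 5) ∧ S.Rigid ∧ S.Quiet ∧
      ∃ s₀ : Stage 1 TowerRates.wide S (Margins.routeG TowerRates.wide) 0,
        ¬ S.LivesTo 1 (S.τ 1) ∨
          ∃ s₁ : Stage 1 TowerRates.wide S (Margins.routeG TowerRates.wide) 1, s₀.Extends s₁)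
    (h : HeredityOrBreakdownFrom 1) :
    Summit.NavierStokesRegularity.NavierStokesRegularity.NavierStokesBreakdownR3 := by
  obtain ⟨S, hP, hR, hQ, s₀, hor⟩ := h₀
  rcases hor with hdead | ⟨s₁, -⟩
  · exact s₀.navierStokesBreakdownR3_of_not_livesTo one_pos (S.τ_pos 1) hdead
  · exact navierStokesBreakdownR3_of_base_orBreakdownFrom_one ⟨S, hP, hR, hQ, ⟨s₁⟩⟩ h

/-- The same with the route's own later binders: host-or-breakdown + `HeredityAtOne` + `HeredityFromTwo` ⇒ (C).
[cite: FeffermanClay2006, (C)] -/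
theorem palasekTowerBreakdown_breakdownR3_of_host_orBreakdown_heredityAtOne_heredityFromTwo
    (h₀ : ∃ S : Schedule TowerRates.wide, S.Pins 8 (6 / 5) ∧ S.Rigid ∧ S.Quiet ∧
      ∃ s₀ : Stage 1 TowerRates.wide S (Margins.routeG TowerRates.wide) 0,
        ¬ S.LivesTo 1 (S.τ 1) ∨
          ∃ s₁ : Stage 1 TowerRates.wide S (Margins.routeG TowerRates.wide) 1, s₀.Extends s₁)
    (h₂ : PalasekTowerBreakdown.HeredityAtOne) (h₃ : PalasekTowerBreakdown.HeredityFromTwo) :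
    Summit.NavierStokesRegularity.NavierStokesRegularity.NavierStokesBreakdownR3 := by
  unfold PalasekTowerBreakdown.HeredityAtOne at h₂
  unfold PalasekTowerBreakdown.HeredityFromTwo at h₃
  exact palasekTowerBreakdown_breakdownR3_of_host_orBreakdown_orBreakdownFrom_one h₀
    ((HeredityAt.orBreakdown (heredityAtOne_iff.1 h₂)).from h₃.orBreakdown)

end Summit.NavierStokesRegularity.NavierStokesRegularity.Theorems
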